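/-
Copyright (c) 2026. All rights reserved.
Released under Apache 2.0 license as described in the file LICENSE.
Authors: abc-iut cell, campaign-S prover seat abc-iut-S1 (wave 1).
-/
import Mathlib.FieldTheory.Galois.Basic
import Mathlib.NumberTheory.Padics.PadicVal.Basic
import Literature.IUT.LogVolume.RamificationInvariants
import Literature.IUT.LogVolume.IntegerRing
import HarnessLib

/-!
# [IUTchIV] Proposition 1.3 (Estimates of Differents) — typed statements

Mochizuki, *Inter-universal Teichmüller theory IV*, RIMS manuscript (Apr. 2020), §1, Proposition 1.3,
kurims pp. 11–12 (proof p. 12; Remark 1.3.1 p. 13: "Similar estimates … may be found in [Ih], Lemma A").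
As printed: "We continue to use the notation of Proposition 1.2. Suppose that `k_0 ⊆ k_i` is a subfield
that contains `ℚ_p`. Write `R_0 := 𝒪_{k_0}` for the ring of integers of `k_0`, `d_0` for the order [i.e.,
"`ord(−)`"] of any generator of the different ideal of `R_0` over `ℤ_p`, `e_0` for the ramification index
of `k_0` over `ℚ_p`, `e_{i/0} := e_i/e_0 (∈ ℤ)`, `[k_i : k_0]` for the degree of the extension `k_i/k_0`,
`n_i` for the unique nonnegative integer such that `[k_i : k_0]/p^{n_i}` is an integer prime to `p`. Then:

 (i) We have: `d_i ≥ d_0 + (e_{i/0} − 1)/(e_{i/0}·e_0) = d_0 + (e_{i/0} − 1)/e_i` — where the "≥" is an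
     equality if `k_i` is tamely ramified over `k_0`.
 (ii) Suppose that `k_i` is a finite Galois extension of a subfield `k_1 ⊆ k_i` such that `k_0 ⊆ k_1`, and
     `k_1` is tamely ramified over `k_0`. Then we have: `d_i ≤ d_0 + n_i + 1/e_0`."

## Modelling (read with the referee)

The subfields `ℚ_p ⊆ k_0 ⊆ k_1 ⊆ k_i` are typed as SEPARATE fields of the cell's norm-side MLF class
related by normed-algebra structures (`[NormedAlgebra k₀ K]`: `k₀ → K` is an isometric `ℚ_p`-embedding
once `IsScalarTower ℚ_[p] k₀ K`, which the statements take as a hypothesis), so that each carries its own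
`absRamificationIdx` (`e`), `differentOrd` (`d`) from `RamificationInvariants.lean` / `IntegerRing.lean`.
"Tamely ramified" (undefined in the text) is the standard notion for local fields with perfect residue
fields: `p ∤ e(k_i/k_0)` (`IsTamelyRamified`; Serre, *Local Fields*, Ch. III §6–7 / Ch. IV §2).
Typed STATEMENTS only (`Prop13i`, `Prop13ii`); the proofs (via Mathlib's `differentIdeal` API:
`pow_sub_one_dvd_differentIdeal`, `dvd_differentIdeal_iff`, transitivity
`differentIdeal_eq_differentIdeal_mul_differentIdeal`) are a separate file of the cell.
-/

noncomputable section

namespace Literature.IUT.LogVolume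

variable (p : ℕ) [Fact p.Prime]
variable (k₀ : Type*) [NontriviallyNormedField k₀] [NormedAlgebra ℚ_[p] k₀] [IsUltrametricDist k₀]
  [ProperSpace k₀]
variable (K : Type*) [NontriviallyNormedField K] [NormedAlgebra ℚ_[p] K] [IsUltrametricDist K]
  [ProperSpace K]

/-! ## Relative invariants of `K/k₀` -/

/-- **`e_{i/0} := e_i/e_0`**, the ramification index of `K` over `k₀` ([IUTchIV] Prop. 1.3, p. 11; an
integer, `e_0 ∣ e_i`). [claim: Mochizuki2012, status: disputed] -/
def relRamificationIdx : ℕ := absRamificationIdx p K / absRamificationIdx p k₀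

/-- **`n_i`**: "the unique nonnegative integer such that `[k_i : k_0]/p^{n_i}` is an integer prime to `p`",
i.e. `n_i = v_p([K : k₀])` ([IUTchIV] Prop. 1.3, p. 11). [claim: Mochizuki2012, status: disputed] -/
def wildExponent [Algebra k₀ K] : ℕ := padicValNat p (Module.finrank k₀ K)

/-- **`K` is tamely ramified over `k₀`**: `p ∤ e(K/k₀)` (the residue fields being finite, hence perfect,
this is the standard definition; the text uses the notion without defining it).
[claim: Mochizuki2012, status: disputed] -/
def IsTamelyRamified : Prop := ¬ p ∣ relRamificationIdx p k₀ K

/-! ## Proposition 1.3 -/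

/-- **[IUTchIV] Proposition 1.3 (i)** (pp. 11–12): for `ℚ_p ⊆ k_0 ⊆ k_i` (an isometric `ℚ_p`-embedding
`k₀ → K`): `d_i ≥ d_0 + (e_{i/0} − 1)/e_i`, with equality if `k_i/k_0` is tamely ramified.
[claim: Mochizuki2012, status: disputed] -/
def Prop13i [NormedAlgebra k₀ K] : Prop :=
  IsScalarTower ℚ_[p] k₀ K →
    differentOrd p k₀ + ((relRamificationIdx p k₀ K : ℝ) - 1) / absRamificationIdx p K ≤
        differentOrd p K ∧
      (IsTamelyRamified p k₀ K →
        differentOrd p K =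
          differentOrd p k₀ + ((relRamificationIdx p k₀ K : ℝ) - 1) / absRamificationIdx p K)

variable (k₁ : Type*) [NontriviallyNormedField k₁] [NormedAlgebra ℚ_[p] k₁] [IsUltrametricDist k₁]
  [ProperSpace k₁]

/-- **[IUTchIV] Proposition 1.3 (ii)** (p. 12): for `ℚ_p ⊆ k_0 ⊆ k_1 ⊆ k_i` with `k_i/k_1` finite Galois
and `k_1/k_0` tamely ramified: `d_i ≤ d_0 + n_i + 1/e_0`. [claim: Mochizuki2012, status: disputed] -/
def Prop13ii [NormedAlgebra k₀ K] [NormedAlgebra k₀ k₁] [NormedAlgebra k₁ K] : Prop :=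
  IsScalarTower ℚ_[p] k₀ K → IsScalarTower ℚ_[p] k₀ k₁ → IsScalarTower ℚ_[p] k₁ K →
    IsScalarTower k₀ k₁ K → FiniteDimensional k₁ K → IsGalois k₁ K → IsTamelyRamified p k₀ k₁ →
      differentOrd p K ≤
        differentOrd p k₀ + (wildExponent p k₀ K : ℝ) + 1 / (absRamificationIdx p k₀ : ℝ)

end Literature.IUT.LogVolume

end
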